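import Summits.RiemannHypothesis.RiemannHypothesis.Theorems.UniversalFactorLehmerRepresentation
import Literature.NumberTheory.LFunctions.LFDSingleGram
import Literature.NumberTheory.LFunctions.LehmanCriticalLineBoundProofs

/-!
# RiemannHypothesis / UniversalFactor — analyticity and sup bounds for the explicit factor
`lehmerCore` on discs and segments near the critical line

Route `RiemannHypothesis/UniversalFactor`, item `LehmerPointNoGo` (stmt-RiemannHypothesis-2582).
The certified quadrature of `UniversalFactorLehmerQuadrature.lean` is applied to
`lehmerF t₀ κ s = lehmerCore t₀ s · e^{κ i (s − s₀)}` (`κ = ∓32`: on the line `s = ½ + it` the last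
factor is the real weight `e^{−32|t − t₀|}` of the one-sided Laplace(16) averages).  This file
provides the analytic inputs of that application, with explicit elementary constants only:

* `UniversalFactor.differentiableOn_lehmerF` — `lehmerF` is holomorphic on `ball (½ + iT) R₁`,
  `R₁ < ½ ≤ T`;
* `UniversalFactor.norm_stirlingPrim_sub_le` — `F = (w−½)Log w − w` is `(log T + 3)`-Lipschitz on
  `closedBall (¼ + iT/2) r`, `r ≤ 1/8`, `T ≥ 4` (mean value inequality, `F' = Log w − 1/(2w)`);
* `UniversalFactor.norm_lehmerF_le_of_mem_sphere` — on `sphere (½+iT) R` (`R ≤ ¼`, `T ≥ 4`):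
  `‖lehmerF‖ ≤ 5(T+1)³ exp(R + (log T + 3)R/2 + D₀ − κ(T − t₀) + |κ|R)`, where
  `D₀ ≥ Re(F(¼+iT/2) − F(¼+it₀/2))`, using `‖ζ(s)‖ ≤ 5‖s‖` (`LFDSingle.norm_riemannZeta_le_five_mul`);
* `UniversalFactor.norm_lehmerF_half_le` — on the segment `|t − T| ≤ ρ ≤ ¼` of the critical line,
  `128π ≤ T − ρ`, `T + ρ ≤ 10⁴`: `‖lehmerF(½+it)‖ ≤ 25.3 (T+1)² exp((log T + 3)ρ/2 + D₀ − κ(T−t₀) + |κ|ρ)`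
  (Lehman's `‖ζ(½+it)‖ ≤ 2.53 t^{1/4}`, `SiegelIntegral.norm_riemannZeta_half_le_lehman`).

References: R. S. Lehman, *On the distribution of zeros of the Riemann zeta-function*, Proc. LMS
(3) 20 (1970), Lemma (critical-line bound); E. C. Titchmarsh (1986), §2.12; folklore.
-/

noncomputable section

set_option linter.dupNamespace false

namespace Summit.RiemannHypothesis.RiemannHypothesis.Theorems

open Complex Real Set Metric
open Literature.NumberTheory.LFunctions
open Literature.Analysis.SpecialFunctions.Complex (stirlingPrim hasDerivAt_stirlingPrim)

/-! ## Analyticity -/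

/-- `lehmerCore t₀` is complex differentiable at every `s` with `Re s > 0`, `s ≠ 1`. [folklore] -/
theorem UniversalFactor.differentiableAt_lehmerCore (t₀ : ℝ) {s : ℂ} (hs : 0 < s.re) (hs1 : s ≠ 1) :
    DifferentiableAt ℂ (UniversalFactor.lehmerCore t₀) s := by
  unfold UniversalFactor.lehmerCore
  have hsp : s / 2 ∈ slitPlane := Or.inl (by simpa using hs)
  have hF : DifferentiableAt ℂ (fun z : ℂ => stirlingPrim (z / 2)) s := by
    have h := (hasDerivAt_stirlingPrim hsp).differentiableAt.comp s
      ((differentiableAt_id (x := s)).div_const (2 : ℂ))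
    simpa [Function.comp_def] using h
  have h1 : DifferentiableAt ℂ (fun z : ℂ => cexp (stirlingPrim (z / 2) - stirlingPrim (thetaArg t₀))) s :=
    (hF.sub_const _).cexp
  have h2 : DifferentiableAt ℂ
      (fun z : ℂ => cexp (-((z - (1 / 2 + t₀ * I)) / 2) * (Real.log π : ℂ))) s := by fun_prop
  have h3 : DifferentiableAt ℂ (fun z : ℂ => z * (1 - z) * cexp (UniversalFactor.thetaMain t₀ * I)) s := by
    fun_prop
  exact ((h3.mul h2).mul h1).mul (differentiableAt_riemannZeta hs1)

/-- `lehmerF t₀ κ` is holomorphic on `ball (½ + iT) R₁` for `R₁ < ½`, `T ≥ 1`. [folklore] -/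
theorem UniversalFactor.differentiableOn_lehmerF (t₀ κ : ℝ) {T R₁ : ℝ} (hR₁ : R₁ < 1 / 2) (hT : 1 ≤ T) :
    DifferentiableOn ℂ (UniversalFactor.lehmerF t₀ κ) (ball (1 / 2 + T * I) R₁) := by
  intro z hz
  rw [mem_ball, dist_eq_norm] at hz
  have e1 : (z - (1 / 2 + T * I)).re = z.re - 1 / 2 := by simp
  have e2 : (z - (1 / 2 + T * I)).im = z.im - T := by simp
  have hre : 0 < z.re := by
    have h := Complex.abs_re_le_norm (z - (1 / 2 + T * I))
    rw [e1] at h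
    have := (abs_le.1 (h.trans hz.le)).1
    linarith
  have him : 0 < z.im := by
    have h := Complex.abs_im_le_norm (z - (1 / 2 + T * I))
    rw [e2] at h
    have := (abs_le.1 (h.trans hz.le)).1
    linarith
  have hz1 : z ≠ 1 := fun h => by rw [h] at him; simp at him
  exact ((UniversalFactor.differentiableAt_lehmerCore t₀ hre hz1).mul
    (by fun_prop : DifferentiableAt ℂ (fun s : ℂ => cexp (κ * I * (s - (1 / 2 + t₀ * I)))) z)).differentiableWithinAt

/-! ## The Lipschitz bound for `stirlingPrim` near `¼ + iT/2` -/

/-- For `T ≥ 4`, `0 ≤ r ≤ 1/8` and `‖w − (¼ + iT/2)‖ ≤ r`: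
`‖F(w) − F(¼ + iT/2)‖ ≤ (log T + 3) r`, `F = stirlingPrim` (`F' = Log w − 1/(2w)` has norm
`≤ log T + π/2 + ½` on the disc). [folklore] -/
theorem UniversalFactor.norm_stirlingPrim_sub_le {T r : ℝ} (hT : 4 ≤ T) (hr0 : 0 ≤ r) (hr : r ≤ 1 / 8)
    {w : ℂ} (hw : w ∈ closedBall (thetaArg T) r) :
    ‖stirlingPrim w - stirlingPrim (thetaArg T)‖ ≤ (Real.log T + 3) * r := by
  have hlogT : 0 ≤ Real.log T := Real.log_nonneg (by linarith)
  -- geometry of the disc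
  have hdisc : ∀ v ∈ closedBall (thetaArg T) r, 1 / 8 ≤ v.re ∧ 1 ≤ v.im ∧ ‖v‖ ≤ T ∧ 1 ≤ ‖v‖ := by
    intro v hv
    rw [mem_closedBall, dist_eq_norm] at hv
    have h1 := Complex.abs_re_le_norm (v - thetaArg T)
    have h2 := Complex.abs_im_le_norm (v - thetaArg T)
    simp only [sub_re, thetaArg_re, sub_im, thetaArg_im] at h1 h2
    have hre := (abs_le.1 (h1.trans hv)).1
    have him := (abs_le.1 (h2.trans hv)).1
    have hvim : 1 ≤ v.im := by linarith
    have hnorm_ge : 1 ≤ ‖v‖ := hvim.trans ((le_abs_self _).trans (Complex.abs_im_le_norm v))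
    have hnorm_le : ‖v‖ ≤ T := by
      have : ‖v‖ ≤ ‖v - thetaArg T‖ + ‖thetaArg T‖ := by
        simpa using norm_add_le (v - thetaArg T) (thetaArg T)
      have hθ : ‖thetaArg T‖ ≤ 1 / 4 + T / 2 := by
        refine (Complex.norm_le_abs_re_add_abs_im _).trans ?_
        rw [thetaArg_re, thetaArg_im, abs_of_nonneg (by norm_num), abs_of_nonneg (by linarith)]
      linarith
    exact ⟨by linarith, hvim, hnorm_le, hnorm_ge⟩
  -- derivative bound on the disc
  have hderiv : ∀ v ∈ closedBall (thetaArg T) r,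
      HasDerivWithinAt stirlingPrim (Complex.log v - 1 / (2 * v)) (closedBall (thetaArg T) r) v := by
    intro v hv
    have hsp : v ∈ slitPlane := Or.inl (by linarith [(hdisc v hv).1])
    exact (hasDerivAt_stirlingPrim hsp).hasDerivWithinAt
  have hbound : ∀ v ∈ closedBall (thetaArg T) r, ‖Complex.log v - 1 / (2 * v)‖ ≤ Real.log T + 3 := by
    intro v hv
    obtain ⟨hre, -, hnle, hnge⟩ := hdisc v hv
    have hv0 : v ≠ 0 := fun h => by rw [h, norm_zero] at hnge; norm_num at hnge
    have hlog : ‖Complex.log v‖ ≤ Real.log T + π / 2 := by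
      refine (Complex.norm_le_abs_re_add_abs_im _).trans ?_
      rw [Complex.log_re, Complex.log_im, abs_of_nonneg (Real.log_nonneg hnge)]
      have h1 : Real.log ‖v‖ ≤ Real.log T := Real.log_le_log (by linarith) hnle
      have h2 : |Complex.arg v| ≤ π / 2 := Complex.abs_arg_le_pi_div_two_iff.2 (by linarith)
      linarith
    have hinv : ‖1 / (2 * v)‖ ≤ 1 / 2 := by
      rw [norm_div, norm_one, norm_mul, Complex.norm_ofNat, div_le_iff₀ (by positivity)]
      linarith
    calc ‖Complex.log v - 1 / (2 * v)‖ ≤ ‖Complex.log v‖ + ‖1 / (2 * v)‖ := norm_sub_le _ _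
      _ ≤ Real.log T + 3 := by linarith [Real.pi_lt_four]
  have hc : thetaArg T ∈ closedBall (thetaArg T) r := mem_closedBall_self hr0
  have h := (convex_closedBall (thetaArg T) r).norm_image_sub_le_of_norm_hasDerivWithin_le
    hderiv hbound hc hw
  refine h.trans ?_
  rw [mem_closedBall, dist_eq_norm] at hw
  exact mul_le_mul_of_nonneg_left hw (by linarith)

/-! ## Elementary numerical facts -/

/-- `log π ≤ 2`. [folklore] -/
theorem UniversalFactor.log_pi_le_two : Real.log π ≤ 2 := by
  rw [Real.log_le_iff_le_exp Real.pi_pos]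
  have h1 : (2.7 : ℝ) < Real.exp 1 := lt_trans (by norm_num) Real.exp_one_gt_d9
  have h2 : Real.exp 2 = Real.exp 1 * Real.exp 1 := by rw [← Real.exp_add]; norm_num
  nlinarith [Real.pi_lt_four, Real.exp_pos 1]

/-- `‖½ + iT‖ ≤ T + ½` for `T ≥ 0`. [folklore] -/
theorem UniversalFactor.norm_half_add_le {T : ℝ} (hT : 0 ≤ T) : ‖(1 : ℂ) / 2 + T * I‖ ≤ T + 1 / 2 := by
  refine (norm_add_le _ _).trans ?_
  rw [norm_mul, Complex.norm_I, mul_one, Complex.norm_real, Real.norm_eq_abs, abs_of_nonneg hT]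
  norm_num; linarith

/-! ## Sup bound on circles -/

/-- **Sup bound for `lehmerF` on the circle `sphere (½ + iT) R`** (`T ≥ 4`, `0 < R ≤ ¼`): with any
`D₀ ≥ Re(F(¼ + iT/2) − F(¼ + it₀/2))`,
`‖lehmerF t₀ κ z‖ ≤ 5(T+1)³ exp(R + (log T + 3)R/2 + D₀ + (−κ(T − t₀) + |κ|R))`. [folklore] -/
theorem UniversalFactor.norm_lehmerF_le_of_mem_sphere {t₀ κ T R D₀ : ℝ} (hT : 4 ≤ T) (hR0 : 0 < R)
    (hR : R ≤ 1 / 4)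
    (hD : (stirlingPrim (thetaArg T) - stirlingPrim (thetaArg t₀)).re ≤ D₀)
    {z : ℂ} (hz : z ∈ sphere ((1 : ℂ) / 2 + T * I) R) :
    ‖UniversalFactor.lehmerF t₀ κ z‖ ≤
      5 * (T + 1) ^ 3 * Real.exp (R + (Real.log T + 3) * R / 2 + D₀ + (-κ * (T - t₀) + |κ| * R)) := by
  rw [mem_sphere, dist_eq_norm] at hz
  set c : ℂ := (1 : ℂ) / 2 + T * I with hc
  have hcn : ‖c‖ ≤ T + 1 / 2 := UniversalFactor.norm_half_add_le (by linarith)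
  have e1 : (z - c).re = z.re - 1 / 2 := by simp [hc]
  have e2 : (z - c).im = z.im - T := by simp [hc]
  have hzre : |z.re - 1 / 2| ≤ R := by rw [← e1]; exact (Complex.abs_re_le_norm _).trans hz.le
  have hzim : |z.im - T| ≤ R := by rw [← e2]; exact (Complex.abs_im_le_norm _).trans hz.le
  -- the six factors
  have hz_norm : ‖z‖ ≤ T + 1 := by
    have : ‖z‖ ≤ ‖z - c‖ + ‖c‖ := by simpa using norm_add_le (z - c) c
    linarith
  have h1z : ‖1 - z‖ ≤ T + 1 := by
    have : ‖1 - z‖ ≤ ‖1 - c‖ + ‖z - c‖ := by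
      simpa [sub_sub_sub_cancel_right] using norm_sub_le (1 - c) (z - c)
    have h1c : ‖1 - c‖ ≤ T + 1 / 2 := by
      have : (1 : ℂ) - c = starRingEnd ℂ c := by
        apply Complex.ext
        · simp [hc]; norm_num
        · simp [hc]
      rw [this, Complex.norm_conj]; exact hcn
    linarith
  have hphase : ‖cexp (UniversalFactor.thetaMain t₀ * I)‖ = 1 := Complex.norm_exp_ofReal_mul_I _
  have hpi : ‖cexp (-((z - (1 / 2 + t₀ * I)) / 2) * (Real.log π : ℂ))‖ ≤ Real.exp R := by
    rw [Complex.norm_exp, Real.exp_le_exp]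
    have : (-((z - (1 / 2 + t₀ * I)) / 2) * (Real.log π : ℂ)).re = -((z.re - 1 / 2) / 2) * Real.log π := by
      simp
    rw [this]
    have hlp := UniversalFactor.log_pi_le_two
    have hlp0 : 0 ≤ Real.log π := Real.log_nonneg (by linarith [Real.pi_gt_three])
    nlinarith [abs_le.1 hzre]
  have hSP : ‖cexp (stirlingPrim (z / 2) - stirlingPrim (thetaArg t₀))‖ ≤
      Real.exp ((Real.log T + 3) * R / 2 + D₀) := by
    rw [Complex.norm_exp, Real.exp_le_exp]
    have hmem : z / 2 ∈ closedBall (thetaArg T) (R / 2) := by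
      rw [mem_closedBall, dist_eq_norm, ← UniversalFactor.half_add_div_two T, ← hc, ← sub_div,
        norm_div, Complex.norm_ofNat]
      linarith
    have hL := UniversalFactor.norm_stirlingPrim_sub_le hT (by linarith) (by linarith) hmem
    have hre : (stirlingPrim (z / 2) - stirlingPrim (thetaArg T)).re ≤ (Real.log T + 3) * (R / 2) :=
      (Complex.re_le_norm _).trans hL
    have : (stirlingPrim (z / 2) - stirlingPrim (thetaArg t₀)).re =
        (stirlingPrim (z / 2) - stirlingPrim (thetaArg T)).re +
          (stirlingPrim (thetaArg T) - stirlingPrim (thetaArg t₀)).re := by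
      simp only [sub_re]; ring
    rw [this]
    linarith
  have hζ : ‖riemannZeta z‖ ≤ 5 * (T + 1) := by
    have h := LFDSingle.norm_riemannZeta_le_five_mul (s := z) (by linarith [(abs_le.1 hzre).1])
      (by rw [le_abs]; left; linarith [(abs_le.1 hzim).1])
    linarith [mul_le_mul_of_nonneg_left hz_norm (by norm_num : (0:ℝ) ≤ 5)]
  have hw : ‖cexp (κ * I * (z - (1 / 2 + t₀ * I)))‖ ≤ Real.exp (-κ * (T - t₀) + |κ| * R) := by
    rw [Complex.norm_exp, Real.exp_le_exp]
    have : (κ * I * (z - (1 / 2 + t₀ * I))).re = -κ * (T - t₀) + -κ * (z.im - T) := by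
      simp; ring
    rw [this]
    have h := abs_le.1 hzim
    have : -κ * (z.im - T) ≤ |κ| * R := by
      calc -κ * (z.im - T) ≤ |-κ * (z.im - T)| := le_abs_self _
        _ = |κ| * |z.im - T| := by rw [abs_mul, abs_neg]
        _ ≤ |κ| * R := mul_le_mul_of_nonneg_left hzim (abs_nonneg _)
    linarith
  -- assemble
  have hT1 : 0 ≤ T + 1 := by linarith
  unfold UniversalFactor.lehmerF UniversalFactor.lehmerCore
  rw [norm_mul, norm_mul, norm_mul, norm_mul, norm_mul, norm_mul, hphase, mul_one]
  calc ‖z‖ * ‖1 - z‖ * ‖cexp (-((z - (1 / 2 + t₀ * I)) / 2) * (Real.log π : ℂ))‖ *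
        ‖cexp (stirlingPrim (z / 2) - stirlingPrim (thetaArg t₀))‖ * ‖riemannZeta z‖ *
        ‖cexp (κ * I * (z - (1 / 2 + t₀ * I)))‖
      ≤ (T + 1) * (T + 1) * Real.exp R * Real.exp ((Real.log T + 3) * R / 2 + D₀) * (5 * (T + 1)) *
          Real.exp (-κ * (T - t₀) + |κ| * R) := by
        gcongr
    _ = 5 * (T + 1) ^ 3 * Real.exp (R + (Real.log T + 3) * R / 2 + D₀ + (-κ * (T - t₀) + |κ| * R)) := by
        simp only [Real.exp_add]; ring

/-! ## Sup bound on segments of the critical line -/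

/-- `t^{1/4} ≤ 10` for `0 ≤ t ≤ 10⁴`. [folklore] -/
theorem UniversalFactor.rpow_quarter_le_ten {t : ℝ} (ht0 : 0 ≤ t) (ht : t ≤ 10000) :
    t ^ (1 / 4 : ℝ) ≤ 10 := by
  have h := Real.rpow_le_rpow ht0 ht (by norm_num : (0:ℝ) ≤ 1 / 4)
  have h10 : (10000 : ℝ) ^ (1 / 4 : ℝ) = 10 := by
    rw [show (10000 : ℝ) = 10 ^ 4 by norm_num, show (1 / 4 : ℝ) = ((4 : ℕ) : ℝ)⁻¹ by norm_num]
    exact Real.pow_rpow_inv_natCast (by norm_num) (by norm_num)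
  rw [h10] at h
  exact h

/-- **Sup bound for `lehmerF` on a segment of the critical line**: for `|t − T| ≤ ρ ≤ ¼`,
`128π ≤ T − ρ`, `T + ρ ≤ 10⁴` and `D₀ ≥ Re(F(¼ + iT/2) − F(¼ + it₀/2))`:
`‖lehmerF t₀ κ (½ + it)‖ ≤ 25.3 (T+1)² exp((log T + 3)ρ/2 + D₀ + (−κ(T − t₀) + |κ|ρ))`
(Lehman's `‖ζ(½+it)‖ ≤ 2.53 t^{1/4} ≤ 25.3`). [folklore] -/
theorem UniversalFactor.norm_lehmerF_half_le {t₀ κ T ρ D₀ : ℝ} (hρ0 : 0 ≤ ρ) (hρ : ρ ≤ 1 / 4)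
    (hT : 128 * π ≤ T - ρ) (hT' : T + ρ ≤ 10000)
    (hD : (stirlingPrim (thetaArg T) - stirlingPrim (thetaArg t₀)).re ≤ D₀)
    {t : ℝ} (ht : |t - T| ≤ ρ) :
    ‖UniversalFactor.lehmerF t₀ κ (1 / 2 + t * I)‖ ≤
      253 / 10 * (T + 1) ^ 2 * Real.exp ((Real.log T + 3) * ρ / 2 + D₀ + (-κ * (T - t₀) + |κ| * ρ)) := by
  have hπ := Real.pi_gt_three
  have ht' := abs_le.1 ht
  have hT4 : 4 ≤ T := by linarith
  have htpos : 0 < t := by linarith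
  -- the factors
  have hss : ‖((1 : ℂ) / 2 + t * I)‖ * ‖1 - (1 / 2 + t * I)‖ ≤ (T + 1) ^ 2 := by
    have e : ‖((1 : ℂ) / 2 + t * I)‖ * ‖1 - (1 / 2 + t * I)‖ = 1 / 4 + t ^ 2 := by
      rw [← norm_mul, show ((1 : ℂ) / 2 + t * I) * (1 - (1 / 2 + t * I)) = ((1 / 4 + t ^ 2 : ℝ) : ℂ) by
        push_cast; ring_nf; rw [Complex.I_sq]; ring, Complex.norm_real, Real.norm_eq_abs,
        abs_of_nonneg (by positivity)]
    rw [e]; nlinarith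
  have hphase : ‖cexp (UniversalFactor.thetaMain t₀ * I)‖ = 1 := Complex.norm_exp_ofReal_mul_I _
  have hpi : ‖cexp (-(((1 : ℂ) / 2 + t * I - (1 / 2 + t₀ * I)) / 2) * (Real.log π : ℂ))‖ = 1 := by
    rw [Complex.norm_exp]
    have : (-(((1 : ℂ) / 2 + t * I - (1 / 2 + t₀ * I)) / 2) * (Real.log π : ℂ)).re = 0 := by simp
    rw [this, Real.exp_zero]
  have hSP : ‖cexp (stirlingPrim (((1 : ℂ) / 2 + t * I) / 2) - stirlingPrim (thetaArg t₀))‖ ≤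
      Real.exp ((Real.log T + 3) * ρ / 2 + D₀) := by
    rw [Complex.norm_exp, Real.exp_le_exp, UniversalFactor.half_add_div_two]
    have hmem : thetaArg t ∈ closedBall (thetaArg T) (ρ / 2) := by
      rw [mem_closedBall, dist_eq_norm, show thetaArg t - thetaArg T = (((t - T) / 2 : ℝ) : ℂ) * I by
        simp only [thetaArg]; push_cast; ring, norm_mul, Complex.norm_I, mul_one, Complex.norm_real,
        Real.norm_eq_abs, abs_div, abs_two]
      linarith
    have hL := UniversalFactor.norm_stirlingPrim_sub_le hT4 (by linarith) (by linarith) hmem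
    have hre : (stirlingPrim (thetaArg t) - stirlingPrim (thetaArg T)).re ≤ (Real.log T + 3) * (ρ / 2) :=
      (Complex.re_le_norm _).trans hL
    have : (stirlingPrim (thetaArg t) - stirlingPrim (thetaArg t₀)).re =
        (stirlingPrim (thetaArg t) - stirlingPrim (thetaArg T)).re +
          (stirlingPrim (thetaArg T) - stirlingPrim (thetaArg t₀)).re := by
      simp only [sub_re]; ring
    rw [this]
    linarith
  have hζ : ‖riemannZeta (1 / 2 + t * I)‖ ≤ 253 / 10 := by
    have h := SiegelIntegral.norm_riemannZeta_half_le_lehman (t := t) (by linarith)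
    have h4 := UniversalFactor.rpow_quarter_le_ten htpos.le (by linarith)
    nlinarith
  have hw : ‖cexp (κ * I * ((1 : ℂ) / 2 + t * I - (1 / 2 + t₀ * I)))‖ ≤ Real.exp (-κ * (T - t₀) + |κ| * ρ) := by
    rw [Complex.norm_exp, Real.exp_le_exp]
    have : (κ * I * ((1 : ℂ) / 2 + t * I - (1 / 2 + t₀ * I))).re = -κ * (T - t₀) + -κ * (t - T) := by
      simp; ring
    rw [this]
    have : -κ * (t - T) ≤ |κ| * ρ := by
      calc -κ * (t - T) ≤ |-κ * (t - T)| := le_abs_self _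
        _ = |κ| * |t - T| := by rw [abs_mul, abs_neg]
        _ ≤ |κ| * ρ := mul_le_mul_of_nonneg_left ht (abs_nonneg _)
    linarith
  have hT1 : 0 ≤ T + 1 := by linarith
  unfold UniversalFactor.lehmerF UniversalFactor.lehmerCore
  rw [norm_mul, norm_mul, norm_mul, norm_mul, norm_mul, norm_mul, hphase, mul_one, hpi, mul_one]
  calc ‖((1 : ℂ) / 2 + t * I)‖ * ‖1 - (1 / 2 + t * I)‖ *
        ‖cexp (stirlingPrim (((1 : ℂ) / 2 + t * I) / 2) - stirlingPrim (thetaArg t₀))‖ *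
        ‖riemannZeta (1 / 2 + t * I)‖ * ‖cexp (κ * I * ((1 : ℂ) / 2 + t * I - (1 / 2 + t₀ * I)))‖
      ≤ (T + 1) ^ 2 * Real.exp ((Real.log T + 3) * ρ / 2 + D₀) * (253 / 10) *
          Real.exp (-κ * (T - t₀) + |κ| * ρ) := by
        gcongr
    _ = 253 / 10 * (T + 1) ^ 2 * Real.exp ((Real.log T + 3) * ρ / 2 + D₀ + (-κ * (T - t₀) + |κ| * ρ)) := by
        simp only [Real.exp_add]; ring

end Summit.RiemannHypothesis.RiemannHypothesis.Theorems
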